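import Summits.KontsevichZagierPeriods.KontsevichZagierPeriods.Theses.AbelContraction
import Summits.KontsevichZagierPeriods.KontsevichZagierPeriods.Theorems.AbelContractionAreasToArcs
import Summits.KontsevichZagierPeriods.KontsevichZagierPeriods.Theorems.AbelContractionDimensionOneGlue
import Summits.KontsevichZagierPeriods.KontsevichZagierPeriods.Theorems.SymplecticScissorsPlanarTransport
import Literature.NumberTheory.Transcendental.CurvePeriods

/-!
# Crux `RealArcKernel` (stmt-KontsevichZagierPeriods-12472, route AbelContraction, rank 0) — line
# `registered` (`Lines/birth.lean`), lead skeleton v2 (2026-08-17, lead c1)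

  `RealArcKernel` : every subgroup `R ≥ KZ.relations` of `KZ.FormalRep` that contains every value-`0`
  element of the one-curve real hyperelliptic sector contains `ker KZ.eval`.

The line is the route's recorded derivation of its GPC-strength target through the input-dimension
filtration (sector ⊂ one-dimensional pairs ⊂ all inputs): `PlanarAreas → AreasToArcs →
ReductionToDimensionOne → RealArcKernel` (landed glue `dimensionOneGlue_proof`, stmt-14404; landed
transfer `areasToArcs_proof`, stmt-0117).

RESHAPE v2 (lead c1, after wave 1). The birth stub `stub_planarAreas` (= item `PlanarAreas`,
stmt-4990, XL) is no longer a stub: the tree already proves it MODULO the cite-only named fact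
`Literature.NumberTheory.Transcendental.HuberWustholzCurvePeriods` (Huber–Wüstholz 2022, Thm 13.3 (2))
— `Summit.KontsevichZagierPeriods.SymplecticScissors.PlanarTransport.planarAreas_of_huberWustholzCurvePeriods`
(Theorems/SymplecticScissorsPlanarTransport.lean; real-clothes transfer, planar compiler, planar
semialgebraic Zylev and null-set bookkeeping all landed). So the 1-period layer of this line is reduced
to that ONE published theorem, registered here as the literature-debt stub
`stub_huberWustholzCurvePeriods` (its statement is the Literature `def … : Prop` BY NAME; it is discharged
by a `theorem HuberWustholzCurvePeriods_holds`, nothing else), and `planarAreas_of_stub` derives the old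
stub's statement from it sorry-free. The other stub is unchanged:

* `stub_reductionToDimensionOne` — the REDUCTION OF THE SUMMIT TO DIMENSION ONE (= item
  `ReductionToDimensionOne`, stmt-14403, GPC-strength, stated openly by the route). It is NECESSARY for
  the crux: `RealArcKernel → ReductionToDimensionOne` is proved sorry-free in
  Theorems/AbelContractionRealArcKernelStrength.lean (`reductionToDimensionOne_of_realArcKernel`,
  p143402: same-dimension merge by rules (1a)/(1b) + the normal form `x ≡ [r] − [r′]` inside dimension
  one), together with `PlanarAreas → (RealArcKernel ↔ ReductionToDimensionOne ↔ KZKernelConjecture ↔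
  KontsevichZagierPeriods)`. Hence: no line of any shape closes stmt-12472 before stmt-14403, and modulo
  Huber–Wüstholz the crux IS stmt-14403 IS the summit.

Composition (sorry-free): `RealArcKernel_of : HuberWustholzCurvePeriods → stub₂-sig → RealArcKernel`
and `realArcKernel_of_stubs : RealArcKernel` (closed modulo the two stubs). No `Disproof.lean` exists for
this crux; negatives index: KinematicPlaneConvex only (no convexity hypothesis here).

References: M. Kontsevich, D. Zagier, *Periods* (2001), §1.2 Conjecture 1; A. Huber, G. Wüstholz,
*Transcendence and Linear Relations of 1-Periods* (2022), Thm 13.3; A. Huber, S. Müller-Stach,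
*Periods and Nori Motives* (2017), Ch. 13; J. Ayoub (2015).
-/

noncomputable section

open Literature.NumberTheory.Transcendental

namespace Summit.KontsevichZagierPeriods.AbelContraction.RealArcKernel

/-! ## Registered stubs -/

/-- **Literature debt: Huber–Wüstholz 2022, Theorem 13.3 (2)** (Kontsevich's period conjecture for
periods of curve type: all `ℚ̄`-linear relations among 1-periods are induced by bilinearity and
functoriality), the tree's cite-only named fact `HuberWustholzCurvePeriods` BY NAME. It is the whole
trust base of the 1-period layer `PlanarAreas` of this line (`planarAreas_of_stub`). Discharged only by
a literature-prover's `HuberWustholzCurvePeriods_holds`. [size XL, published theorem]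
[cite: HuberWustholz2022, Thm. 13.3 (2)] -/
theorem stub_huberWustholzCurvePeriods : HuberWustholzCurvePeriods := by
  sorry

/-- **Reduction of the summit to dimension one** (`ReductionToDimensionOne`,
stmt-KontsevichZagierPeriods-14403; GPC-strength, stated openly): every subgroup `R ≥ KZ.relations`
that contains `[r] − [r′]` for every equal-valued pair of one-dimensional representations contains
`ker KZ.eval`. NECESSARY for the crux (`reductionToDimensionOne_of_realArcKernel`, p143402) and, with
the 1-period layer, sufficient (`RealArcKernel_of`). Why it might fail: false iff some value-`0`
combination outside the 1-period layer is underivable (route Neg's bets) — and then the summit is false.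
[size open-problem] [cite: KontsevichZagier2001, §1.2] -/
theorem stub_reductionToDimensionOne :
    ∀ R : AddSubgroup KZ.FormalRep, KZ.relations ≤ R →
      (∀ (r r' : KZ.IntegralRep 1), r.value = r'.value → KZ.of r - KZ.of r' ∈ R) →
      ∀ x : KZ.FormalRep, KZ.eval x = 0 → x ∈ R := by
  sorry

/-! ## The old stub `stub_planarAreas` is now derived (sorry-free over `stub_huberWustholzCurvePeriods`) -/

/-- The 1-period layer of the line (birth stub `stub_planarAreas` = item `PlanarAreas`, stmt-4990,
verbatim) from the literature-debt stub, through the landed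
`planarAreas_of_huberWustholzCurvePeriods` (route SymplecticScissors; `SymplecticScissors.PlanarAreas`
and `AbelContraction.PlanarAreas` are the same term). [cite: HuberWustholz2022, Thm. 13.3 (2)] -/
theorem planarAreas_of_stub :
    ∀ (r r' : KZ.IntegralRep 2), (∀ p ∈ r.domain, r.integrand p = 1) →
      (∀ p ∈ r'.domain, r'.integrand p = 1) → r.value = r'.value → KZ.Equivalent r r' :=
  Summit.KontsevichZagierPeriods.SymplecticScissors.PlanarTransport.planarAreas_of_huberWustholzCurvePeriods
    stub_huberWustholzCurvePeriods

/-! ## The stubs are the route's items / the Literature fact verbatim (kernel-checked identifications) -/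

example : (∀ R : AddSubgroup KZ.FormalRep, KZ.relations ≤ R →
      (∀ (r r' : KZ.IntegralRep 1), r.value = r'.value → KZ.of r - KZ.of r' ∈ R) →
      ∀ x : KZ.FormalRep, KZ.eval x = 0 → x ∈ R) ↔
    Summit.KontsevichZagierPeriods.KontsevichZagierPeriods.Theses.AbelContraction.ReductionToDimensionOne :=
  Iff.rfl

example : (∀ (r r' : KZ.IntegralRep 2), (∀ p ∈ r.domain, r.integrand p = 1) →
      (∀ p ∈ r'.domain, r'.integrand p = 1) → r.value = r'.value → KZ.Equivalent r r') ↔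
    Summit.KontsevichZagierPeriods.KontsevichZagierPeriods.Theses.AbelContraction.PlanarAreas :=
  Iff.rfl

/-! ## Composition (sorry-free): the two stubs imply the crux BY NAME -/

/-- **`RealArcKernel_of`**: Huber–Wüstholz's curve-period theorem and the reduction to dimension one
imply the crux `AbelContraction.RealArcKernel`: the landed `planarAreas_of_huberWustholzCurvePeriods`
gives the 1-period layer, the landed transfer `areasToArcs_proof` (stmt-0117) turns it into
`[r] − [r′] ∈ KZ.relations ≤ R` for every equal-valued one-dimensional pair, and the reduction puts
`ker KZ.eval` inside `R` (landed glue `dimensionOneGlue_proof`, stmt-14404); the crux's sector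
hypothesis is discarded. [cite: KontsevichZagier2001, §1.2] -/
theorem RealArcKernel_of :
    HuberWustholzCurvePeriods →
    (∀ R : AddSubgroup KZ.FormalRep, KZ.relations ≤ R →
      (∀ (r r' : KZ.IntegralRep 1), r.value = r'.value → KZ.of r - KZ.of r' ∈ R) →
      ∀ x : KZ.FormalRep, KZ.eval x = 0 → x ∈ R) →
    Summit.KontsevichZagierPeriods.KontsevichZagierPeriods.Theses.AbelContraction.RealArcKernel := by
  intro hHW hRed
  exact Summit.KontsevichZagierPeriods.AbelContraction.dimensionOneGlue_proof
    (Summit.KontsevichZagierPeriods.SymplecticScissors.PlanarTransport.planarAreas_of_huberWustholzCurvePeriods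
      hHW)
    Summit.KontsevichZagierPeriods.AbelContraction.AreasToArcs.areasToArcs_proof hRed

/-- The crux from the stubs themselves (so that a lead closing both stubs closes the item). -/
theorem realArcKernel_of_stubs :
    Summit.KontsevichZagierPeriods.KontsevichZagierPeriods.Theses.AbelContraction.RealArcKernel :=
  RealArcKernel_of stub_huberWustholzCurvePeriods stub_reductionToDimensionOne

end Summit.KontsevichZagierPeriods.AbelContraction.RealArcKernel

end
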